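import Summits.BirchSwinnertonDyer.BirchSwinnertonDyer.Theorems.ManinLocalTwoThreeNoAscendingTameThree
import Summits.BirchSwinnertonDyer.BirchSwinnertonDyer.Theorems.ManinLocalTwoThreeTameAdditiveTypesAtThree
import Summits.BirchSwinnertonDyer.BirchSwinnertonDyer.Theorems.ManinLocalTwoThreeTriplingProfileNineP
import HarnessLib

/-!
# NB₃^V on the whole potentially-good tame cell at `3` except `I₀*`; the tripling profile at `9p` for potentially good
# optimal curves: `W₀` is `III` (and then `W₁` is `III*`) or `W₀` is `I₀*`

Summit `BirchSwinnertonDyer`, route `ManinLocalTwoThree` (cell bsd-f2-manin), deciding crux C3 `ManinPrimeToThreeAtNine`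
(stmt-BirchSwinnertonDyer-22968).  p649622 (`…NoAscendingTameThree`: no ascent of a rational `3`-torsion point on `III`, none exists on `III*`)
and p649207 (`…TriplingProfileNineP`) read through the classification p650740 (`…TameAdditiveTypesAtThree`: `9 ∥ N`, `ord₃ j ≥ 0` ⟹
`ord₃ Δ_min ∈ {3, 6, 9}`):

* `noAscendingThreeTorsion_of_nine_dvd_of_j_of_ne_six` — the lead's stub `NoAscendingThreeTorsionOptimal` holds, WITHOUT optimality, for
  every globally minimal `W` with `9 ∥ N(W)`, `ord₃ j ≥ 0` and `ord₃ Δ_min ≠ 6`: its residual on the potentially good tame cell is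
  EXACTLY the `I₀*` stratum (where it is a position law).
* `tripling_profile_potGood_nine_mul_prime` — at `N = 9p` (`p ≡ 2 (3)`; `exists_isNewformOf`): `|c₀| = 3|c₁|` and `ord₃ j(W₀) ≥ 0` ⟹
  (`ord₃ Δ_min(W₀) = 3 ∧ ord₃ Δ_min(W₁) = 9`) ∨ `ord₃ Δ_min(W₀) = 6`.

HONEST FRAMING: C3, Manin's conjecture and BSD are not proved.  No definitions, no named facts, no sorry.
References: [SilvermanATAEC1994] IV.9.4 Table 4.1; [CesnaviciusNeururerSaha2023] Lemma 6.5; HOME/MEMO-an.md §66–§67.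
-/

set_option autoImplicit false
set_option linter.dupNamespace false

noncomputable section

open scoped Classical
open WeierstrassCurve Literature.NumberTheory.EllipticCurves Literature.NumberTheory.EllipticCurves.ModularForms
open CongruenceSubgroup Polynomial
open Summit.BirchSwinnertonDyer.Rank1Residual.ManinAdditive.CuspidalKummer
open Summit.BirchSwinnertonDyer.Rank1Residual.ManinAdditive.CuspidalKummerThree

namespace Summit.BirchSwinnertonDyer.BirchSwinnertonDyer.Theorems.ManinLocalTwoThree

/-- **NB₃^V on the potentially good tame cell at `3` minus `I₀*`, without optimality:** `W` globally minimal, `9 ∥ N(W)`, `ord₃ j ≥ 0`,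
`ord₃ Δ_min ≠ 6`, `(X₁, Y₁)` a rational `3`-torsion point of `E_{W,1}` ⟹ no globally minimal curve carries the thrice-divided Vélu pair.
[cite: SilvermanATAEC1994, IV.9.4 Table 4.1] -/
theorem noAscendingThreeTorsion_of_nine_dvd_of_j_of_ne_six (W : WeierstrassCurve ℚ) [W.IsElliptic] [W.IsGloballyMinimal]
    (h9 : 3 ^ 2 ∣ W.conductorNorm ℤ) (h27 : ¬ 3 ^ 3 ∣ W.conductorNorm ℤ) (hj : 0 ≤ padicValRat 3 W.j)
    (h6 : padicValInt 3 W.minimalDiscriminantInt ≠ 6) (X₁ Y₁ : ℚ) (hT : IsShortThreeTorsion W 1 X₁ Y₁) :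
    ¬ ∃ W' : WeierstrassCurve ℚ, W'.IsElliptic ∧ W'.IsGloballyMinimal ∧
        (3 : ℚ) ^ 4 * W'.c₄ = 1440 * X₁ ^ 2 - 9 * W.c₄ ∧
        (3 : ℚ) ^ 6 * W'.c₆ = 60480 * X₁ ^ 3 - 756 * W.c₄ * X₁ - 27 * W.c₆ := by
  rcases padicValInt_three_minimalDiscriminantInt_of_nine_dvd_conductorNorm_of_j W h9 h27 hj with h | h | h
  · exact noAscendingThreeTorsion_of_tame_potGood_three W h9 h27 (Or.inl h) X₁ Y₁ hT
  · exact absurd h h6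
  · exact noAscendingThreeTorsion_of_tame_potGood_three W h9 h27 (Or.inr ⟨h, hj⟩) X₁ Y₁ hT

variable {W₁ W₀ : WeierstrassCurve ℚ} [W₁.IsElliptic] [W₁.IsGloballyMinimal] [W₀.IsElliptic] [W₀.IsGloballyMinimal]

/-- **The tripling profile at `N = 9p` for potentially good optimal curves:** `p ≡ 2 (mod 3)` prime, the Modularity Theorem
`exists_isNewformOf`, `(D₁, D₀)` the optimal `X₁(9p)`/`X₀(9p)` pair of a class, `ord₃ j(W₀) ≥ 0`: `|c₀| = 3|c₁|` ⟹
`W₀` is of type `III` with `W₁` of type `III*` (`ord₃ Δ_min = 3, 9`), or `W₀` is of type `I₀*` (`ord₃ Δ_min(W₀) = 6`).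
[cite: CesnaviciusNeururerSaha2023, Lemma 6.5] [cite: SilvermanATAEC1994, IV.9.4 Table 4.1] -/
theorem tripling_profile_potGood_nine_mul_prime (hnf : exists_isNewformOf) {p : ℕ} (hp : p.Prime) (hp3 : p % 3 = 2)
    [NeZero (9 * p)] (D₁ : Gamma1ParametrizationData W₁ (9 * p)) (D₀ : ModularParametrizationData W₀ (9 * p))
    (hiso : IsIsogenous W₁ W₀) (h₁ : D₁.IsOptimal)
    (h₀ : ∀ z ∈ D₀.L.lattice, ∃ w ∈ periodLattice D₀.f, z = D₀.c * w) (hj : 0 ≤ padicValRat 3 W₀.j)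
    (htri : D₀.maninConstant.natAbs = 3 * D₁.maninConstant.natAbs) :
    (padicValInt 3 W₀.minimalDiscriminantInt = 3 ∧ padicValInt 3 W₁.minimalDiscriminantInt = 9) ∨
      padicValInt 3 W₀.minimalDiscriminantInt = 6 := by
  obtain ⟨h9, h27⟩ := nine_dvd_not_twentyseven_dvd_conductorNorm_of_level_nine_mul_prime hnf hp hp3 D₀
  obtain ⟨hIIIstar, hIII⟩ := tripling_profile_nine_mul_prime hnf hp hp3 D₁ D₀ hiso h₁ h₀ htri
  rcases padicValInt_three_minimalDiscriminantInt_of_nine_dvd_conductorNorm_of_j W₀ h9 h27 hj with h | h | h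
  · exact Or.inl ⟨h, hIII h⟩
  · exact Or.inr h
  · exact absurd hj (not_le.mpr (hIIIstar h))

end Summit.BirchSwinnertonDyer.BirchSwinnertonDyer.Theorems.ManinLocalTwoThree

end
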